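import Summits.QuantumFields.YangMills.Theorems.UnitScaleTiltProp7FlatSubsolutionMeanValue
import Literature.MathematicalPhysics.QuantumFieldTheory.Balaban1983to89.B9TorusCalculus
import HarnessLib

/-!
# Line «poincare_lipschitz» on crux `HistoryTailL` (stmt-QuantumFields-19936), route crux `BlockLipschitzL` (stmt-QuantumFields-23533), K2 supplier plan,
# (R3)-COV — THE LATTICE KATO INEQUALITY: the norm of a COVARIANTLY harmonic `𝔸`-valued function is FLAT-subharmonic, for ANY norm-non-increasing
# transport; hence the covariant interior mean-value bound `‖h(x₀)‖² ≤ 16(336·d·2^d)^d·R^{−d}·Σ_{Q_R(x₀)}‖h‖²` with the FLAT constants and NO smallness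
# of the background (the tree's flat De Giorgi brick ✓`Prop7FlatSubsolutionMeanValue.sq_le_of_laplace_nonpos_nonneg_torus` applied to `‖h‖`)

Cell `ym3-torus` (YM ladder rung R3 = continuum SU(2) Yang–Mills on the three-torus — a RUNG, NOT the Clay problem: not d = 4, not infinite volume, not a
mass gap); width seat `ym3-torus-px7` gen 4 (bus 2026-08-29T01:0xZ «KATO» offer; LEAD ym-ust-19936-w1 g7's question on the covariant road's first brick).
THEOREMS ONLY (def-free); letters of ✓`B9Eq39Adjoint` (`R U X = U·X·U⁻¹`, `covD`, `covDstar`; adjoint transport, w5-19936 g10 00:59:21Z) and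
✓`B9TorusCalculus.torusT`; `--supports stmt-QuantumFields-23533`.  Nothing here proves the (R3)-COV row, `hStab`, F5/F6, a stub, `BlockLipschitzL`,
`HistoryTailL` or a summit statement.

WHY.  Card v1.28: F6 lands conditional on ONE displayed «(R3)-COV ROW» (covariant interior regularity); its concrete supplier is the covariant Campanato road
(w5's (R3)-COV LOCATE §4: (a) covariant Caccioppoli, (b) harmonic replacement + mean value, (c) Campanato/Morrey, (d) Weitzenböck ✓`B11Eq135Weitzenbock`, (e)
assembly).  LEAD asked (01:00Z) whether brick one should re-prove the flat `B4Eq19Lattice*` chain vector-valued and absorb the background as an `O(τ)` source.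
For the HARMONIC HALF of (b) the answer is: no perturbation at all.  If `Σ_μ D*_μ D_μ h = 0` with transports `R(U)`, `R(U)⁻¹` that do not increase the norm,
then `2d·h(x) = Σ_μ [R(U_μ(x−e_μ))⁻¹ h(x−e_μ) + R(U_μ(x)) h(x+e_μ)]` EXACTLY (§1), so `z := ‖h‖` is non-negative and FLAT-SUBHARMONIC
(`2d·z(x) ≤ Σ_μ (z(x+e_μ) + z(x−e_μ))`), and the tree's flat De Giorgi sub-mean-value inequality applies to `z` VERBATIM: constants flat, background ARBITRARY
(unitary ⇒ isometric transport).  With a source the same computation gives KATO WITH SOURCE `−Δ_flat‖w‖ ≤ ‖Σ_μ D*_μ D_μ w‖` pointwise (§1), the domination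
step for the Dirichlet corrector.  (Where the background size genuinely enters is the curvature operator `𝒦` of the Weitzenböck identity — bus 01:0xZ.)

* §1 (abstract: any normed ring `𝔸`, any site set `S`, shifts `T : ι → Perm S`, units `U : ι → S → 𝔸ˣ`): `covDstar_covD_apply` — the EXACT expansion
  `(D*_μ D_μ f)(x) = 2f(x) − R(U_μ(T_μ⁻¹x))⁻¹ f(T_μ⁻¹x) − R(U_μ x) f(T_μ x)`; ★ `kato_pointwise` — if `‖R(U_μ x)X‖ ≤ ‖X‖` and `‖R(U_μ x)⁻¹X‖ ≤ ‖X‖` then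
  `2·|ι|·‖f x‖ − Σ_μ (‖f(T_μ x)‖ + ‖f(T_μ⁻¹ x)‖) ≤ ‖Σ_μ (D*_μ D_μ f)(x)‖`.
* §2 (the tori `Site P j` of `Setup`, `T = torusT P j`): ★ `laplace_norm_le_norm_covLap` — `laplace 1 (‖f ·‖) x ≤ ‖Σ_μ (D*_μ D_μ f)(x)‖` (Kato with source, in
  `LatticeFieldCalculus.laplace` letters); `laplace_norm_nonpos_of_covHarmonic`.
* §3 ★★ `normSq_le_of_covHarmonic` — `d ≥ 1`, `R ≥ 4`: if `Σ_μ D*_μ D_μ h = 0` at the sites `transl x₀ w`, `w ∈ Q_R(0)`, then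
  `‖h x₀‖² ≤ 16(336·d·2^d)^d·R^{−d}·Σ_{w ∈ Q_R(0)} ‖h (transl x₀ w)‖²` — the covariant interior mean-value bound, flat constants, any non-expanding transport.
[folklore] (Kato's inequality on the lattice; [Balaban1984PropagatorsII] (1.9) p.226 for the flat locus the constants come from).
-/

set_option autoImplicit false

noncomputable section

open scoped BigOperators

namespace Summit.QuantumFields.YangMills.Theorems.PoincareLipschitzCovariantKato

open Literature.MathematicalPhysics.QuantumFieldTheory.Balaban1983to89
open Literature.MathematicalPhysics.QuantumFieldTheory.Balaban1983to89.B9Eq39Adjoint (R R_def covD covDstar)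
open Literature.MathematicalPhysics.QuantumFieldTheory.Balaban1983to89.B9TorusCalculus (torusT torusT_apply torusT_symm_apply)
open B4Eq19LatticeOperators (box)
open B10Eq27TorusAxialLog (transl)
open Summit.QuantumFields.YangMills.Theorems.Prop7FlatSubsolutionMeanValue (sq_le_of_laplace_nonpos_nonneg_torus)

/-! ## §1 The exact expansion of `D*_μ D_μ` and the pointwise Kato inequality (abstract lattice) -/

section Abstract

variable {𝔸 : Type*} [NormedRing 𝔸] [NormedAlgebra ℝ 𝔸] {S : Type*} {ι : Type*} (T : ι → Equiv.Perm S) (U : ι → S → 𝔸ˣ)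

omit [NormedRing 𝔸] [NormedAlgebra ℝ 𝔸] in
/-- `R V⁻¹ (R V X) = X`. [folklore] -/
theorem R_inv_R {𝔸 : Type*} [Ring 𝔸] (V : 𝔸ˣ) (X : 𝔸) : R V⁻¹ (R V X) = X := by
  simp only [R_def, inv_inv]
  calc ((V⁻¹ : 𝔸ˣ) : 𝔸) * ((V : 𝔸) * X * ((V⁻¹ : 𝔸ˣ) : 𝔸)) * (V : 𝔸)
      = (((V⁻¹ : 𝔸ˣ) : 𝔸) * (V : 𝔸)) * X * (((V⁻¹ : 𝔸ˣ) : 𝔸) * (V : 𝔸)) := by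
        simp only [mul_assoc]
    _ = X := by rw [Units.inv_mul, one_mul, mul_one]

/-- **THE EXACT EXPANSION**: `(D*_μ D_μ f)(x) = (f(x) + f(x)) − R(U_μ(T_μ⁻¹x))⁻¹ f(T_μ⁻¹x) − R(U_μ x) f(T_μ x)`.
[cite: Balaban1985BackgroundPropagators, (3.3), (3.8) pp.390-392] -/
theorem covDstar_covD_apply {𝔸 : Type*} [Ring 𝔸] (T : ι → Equiv.Perm S) (U : ι → S → 𝔸ˣ) (μ : ι) (f : S → 𝔸) (x : S) :
    covDstar T U μ (covD T U μ f) x = (f x + f x) - R (U μ ((T μ).symm x))⁻¹ (f ((T μ).symm x)) - R (U μ x) (f (T μ x)) := by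
  simp only [covDstar, covD, Equiv.apply_symm_apply]
  rw [B9Eq39Adjoint.R_sub, R_inv_R]
  abel

/-- ★ **KATO, POINTWISE**: if the transports `R(U_μ x)`, `R(U_μ x)⁻¹` do not increase the norm (unitary backgrounds), then for every `f` and `x`:
`2·|ι|·‖f x‖ − Σ_μ (‖f(T_μ x)‖ + ‖f(T_μ⁻¹ x)‖) ≤ ‖Σ_μ (D*_μ D_μ f)(x)‖` — the norm of `f` is a flat subsolution with source `‖Δ_U f‖`. [folklore] -/
theorem kato_pointwise [Fintype ι] (hR : ∀ (μ : ι) (x : S) (X : 𝔸), ‖R (U μ x) X‖ ≤ ‖X‖)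
    (hRinv : ∀ (μ : ι) (x : S) (X : 𝔸), ‖R (U μ x)⁻¹ X‖ ≤ ‖X‖) (f : S → 𝔸) (x : S) :
    2 * (Fintype.card ι : ℝ) * ‖f x‖ - ∑ μ, (‖f (T μ x)‖ + ‖f ((T μ).symm x)‖) ≤ ‖∑ μ, covDstar T U μ (covD T U μ f) x‖ := by
  -- `Σ_μ D*D f = (2|ι|) • f(x) − Σ_μ (transported neighbours)`
  set N : 𝔸 := ∑ μ, (R (U μ ((T μ).symm x))⁻¹ (f ((T μ).symm x)) + R (U μ x) (f (T μ x))) with hN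
  have hexp : ∑ μ, covDstar T U μ (covD T U μ f) x = ((2 * (Fintype.card ι : ℕ) : ℝ)) • f x - N := by
    simp_rw [covDstar_covD_apply]
    rw [Finset.sum_sub_distrib, Finset.sum_sub_distrib, Finset.sum_const, Finset.card_univ, hN, Finset.sum_add_distrib, sub_sub]
    congr 1
    rw [← two_smul ℕ (f x), ← mul_nsmul', ← Nat.cast_smul_eq_nsmul ℝ]
    push_cast
    ring_nf
  have hnb : ‖N‖ ≤ ∑ μ, (‖f (T μ x)‖ + ‖f ((T μ).symm x)‖) := by
    rw [hN]
    refine (norm_sum_le _ _).trans (Finset.sum_le_sum fun μ _ => (norm_add_le _ _).trans ?_)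
    have h1 := hRinv μ ((T μ).symm x) (f ((T μ).symm x))
    have h2 := hR μ x (f (T μ x))
    linarith
  have hsm : ‖((2 * (Fintype.card ι : ℕ) : ℝ)) • f x‖ = 2 * (Fintype.card ι : ℝ) * ‖f x‖ := by
    rw [norm_smul, Real.norm_of_nonneg (by positivity)]
  have hmain : ‖((2 * (Fintype.card ι : ℕ) : ℝ)) • f x‖ ≤ ‖∑ μ, covDstar T U μ (covD T U μ f) x‖ + ‖N‖ := by
    have e : ((2 * (Fintype.card ι : ℕ) : ℝ)) • f x = (∑ μ, covDstar T U μ (covD T U μ f) x) + N := by rw [hexp, sub_add_cancel]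
    rw [e]
    exact norm_add_le _ _
  rw [hsm] at hmain
  linarith

end Abstract

/-! ## §2 On the tori `T^{(j)}` of `Setup`: Kato in `LatticeFieldCalculus.laplace` letters -/

section Torus

variable {𝔸 : Type*} [NormedRing 𝔸] [NormedAlgebra ℝ 𝔸] {P : Params} {j : ℕ} (U : Fin P.d → Site P j → 𝔸ˣ)

/-- ★ **KATO WITH SOURCE ON THE TORUS**: for unitary-type backgrounds (`‖R(U)X‖ ≤ ‖X‖`, `‖R(U)⁻¹X‖ ≤ ‖X‖`),
`laplace 1 (‖f ·‖) x ≤ ‖Σ_μ (D*_μ D_μ f)(x)‖` at every site (`torusT`: `T_μ x = x + e_μ`, `T_μ⁻¹ x = x − e_μ`). [folklore] -/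
theorem laplace_norm_le_norm_covLap (hR : ∀ (μ : Fin P.d) (x : Site P j) (X : 𝔸), ‖R (U μ x) X‖ ≤ ‖X‖)
    (hRinv : ∀ (μ : Fin P.d) (x : Site P j) (X : 𝔸), ‖R (U μ x)⁻¹ X‖ ≤ ‖X‖) (f : Site P j → 𝔸) (x : Site P j) :
    LatticeFieldCalculus.laplace 1 (fun y => ‖f y‖) x ≤ ‖∑ μ, covDstar (torusT P j) U μ (covD (torusT P j) U μ f) x‖ := by
  have h := kato_pointwise (torusT P j) U hR hRinv f x
  have hlap : LatticeFieldCalculus.laplace 1 (fun y => ‖f y‖) x =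
      2 * (Fintype.card (Fin P.d) : ℝ) * ‖f x‖ - ∑ μ, (‖f (torusT P j μ x)‖ + ‖f ((torusT P j μ).symm x)‖) := by
    simp only [LatticeFieldCalculus.laplace, one_pow, one_smul, torusT_apply, torusT_symm_apply, Fintype.card_fin]
    rw [Finset.sum_sub_distrib, Finset.sum_sub_distrib, Finset.sum_const, Finset.card_univ, Fintype.card_fin, Finset.sum_add_distrib,
      nsmul_eq_mul]
    ring
  rw [hlap]
  exact h

/-- **The norm of a covariantly harmonic function is flat-subharmonic**: `Σ_μ D*_μ D_μ h (x) = 0 ⇒ laplace 1 ‖h‖ (x) ≤ 0`. [folklore] -/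
theorem laplace_norm_nonpos_of_covHarmonic (hR : ∀ (μ : Fin P.d) (x : Site P j) (X : 𝔸), ‖R (U μ x) X‖ ≤ ‖X‖)
    (hRinv : ∀ (μ : Fin P.d) (x : Site P j) (X : 𝔸), ‖R (U μ x)⁻¹ X‖ ≤ ‖X‖) (h : Site P j → 𝔸) (x : Site P j)
    (hx : ∑ μ, covDstar (torusT P j) U μ (covD (torusT P j) U μ h) x = 0) :
    LatticeFieldCalculus.laplace 1 (fun y => ‖h y‖) x ≤ 0 := by
  have h1 := laplace_norm_le_norm_covLap U hR hRinv h x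
  rw [hx, norm_zero] at h1
  exact h1

/-! ## §3 ★★ The covariant interior mean-value bound, flat constants, arbitrary unitary-type background -/

/-- ★★ **THE COVARIANT MEAN-VALUE BOUND.**  `d ≥ 1`, `R ≥ 4`; transports non-expanding; if `Σ_μ D*_μ D_μ h = 0` at every site `transl x₀ w`, `w ∈ Q_R(0)`
(covariantly harmonic on the pulled-back box), then `‖h x₀‖² ≤ 16·(336·d·2^d)^d·R^{−d}·Σ_{w ∈ Q_R(0)} ‖h (transl x₀ w)‖²` — the flat De Giorgi brick
✓`sq_le_of_laplace_nonpos_nonneg_torus` applied to the non-negative flat subsolution `‖h‖` (§2).  No smallness of `U`, no period hypothesis.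
[folklore] [cite: Balaban1984PropagatorsII, (1.9) p.226] -/
theorem normSq_le_of_covHarmonic (hd : 1 ≤ P.d) (hR : ∀ (μ : Fin P.d) (x : Site P j) (X : 𝔸), ‖R (U μ x) X‖ ≤ ‖X‖)
    (hRinv : ∀ (μ : Fin P.d) (x : Site P j) (X : 𝔸), ‖R (U μ x)⁻¹ X‖ ≤ ‖X‖) (h : Site P j → 𝔸) (x₀ : Site P j) {Rad : ℤ} (hRad : 4 ≤ Rad)
    (hharm : ∀ w ∈ box (0 : B4Eq19LatticeOperators.Zd P.d) Rad, ∑ μ, covDstar (torusT P j) U μ (covD (torusT P j) U μ h) (transl x₀ w) = 0) :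
    ‖h x₀‖ ^ 2 ≤ 16 * (336 * (P.d : ℝ) * (2 : ℝ) ^ P.d) ^ P.d / (Rad : ℝ) ^ P.d * ∑ w ∈ box (0 : B4Eq19LatticeOperators.Zd P.d) Rad, ‖h (transl x₀ w)‖ ^ 2 :=
  sq_le_of_laplace_nonpos_nonneg_torus hd x₀ (fun y => ‖h y‖) (fun _ => norm_nonneg _) hRad
    (fun w hw => laplace_norm_nonpos_of_covHarmonic U hR hRinv h _ (hharm w hw))

end Torus

end Summit.QuantumFields.YangMills.Theorems.PoincareLipschitzCovariantKato

end
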